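import Summits.HodgeConjecture.HodgeConjecture.Theorems.LinearSystemTorelliLocalTubeSpanThinDynamicsLemmas

/-!
# Route LinearSystemTorelli — crux `LocalTubeSpan`: the thin configuration — ping-pong dynamics

Helper file (`--supports stmt-HodgeConjecture-2490`, line `Sketch`, stub `stub_thinDynamics`, the
cycle-3 hardest stub, taken by the line lead).  The crux ("local Schnell theorem", C. Schnell,
*Primitive cohomology and the tube mapping*, Math. Z. 268 (2010) §3, §7) asks that Schnell's third
map `H¹(G, V) → ∏_g V/(g - 1)V` be injective for LOCAL monodromy groups acting by Picard–Lefschetz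
transvections; Schnell's Prop. 12 proves this when the cycles form a skew-symmetric vanishing lattice
(W. Janssen, Math. Ann. 266 (1983)).  The line's THIN BOUNDARY shows the statement is false for
general integral symplectic transvection configurations: on `V = ℚ²` with `B₀(x, y) = 4(x₀y₁ - x₁y₀)`
the transvections along `δ₁ = (1,0)`, `δ₂ = (0,1)`, `δ₃ = (1,1)` are
`T₁(v) = (v₀ + 4v₁, v₁)`, `T₂(v) = (v₀, v₁ - 4v₀)`, `T₃(v) = v - 4(v₀ - v₁)(1,1)`, and they play
ping-pong on the three cones `C₁ = {2|v₁| ≤ |v₀|}`, `C₂ = {2|v₀| ≤ |v₁|}`,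
`C₃ = {4|v₀ - v₁| ≤ |v₀ + v₁|}` (pairwise meeting in `0` only; `T_i^n`, `n ≠ 0`, maps the complement
of the interior of `C_i` into `C_i`).

* `localTubeSpan_thinDynamics` — the registered stub: in ANY group with three elements acting as
  `T₁, T₂, T₃`, a cyclically reduced alternating product `∏ (τ i_ℓ)^{n_ℓ}` (non-zero exponents,
  consecutive letters distinct, first letter ≠ last letter) acts with `g - 1` INVERTIBLE.  Proof: the
  product maps the complement of the core of the last cone into the first cone, so it is not the
  identity; it has determinant one, so a fixed vector would make it unipotent `1 + N`, `N² = 0`,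
  `N ≠ 0`; then the forward orbit `η + nNη` of a vector `η` of the third cone stays in the first cone
  and the backward orbit `η - nNη` in the last cone, forcing `Nη` into both (cones are closed under
  the limit `n → ∞`), i.e. `Nη = 0` for two independent `η` — contradiction.
* The elementary lemmas (closedness of cone inequalities under `n → ∞`, `2 × 2` unipotency from
  determinant one, `(1 + N)^n = 1 + nN`, disjointness of the cones, the power formula of the
  transvections, determinant one) are in the companion file `…ThinDynamicsLemmas`.

No named facts; pure linear algebra over `ℚ`.

References: [Schnell2010] C. Schnell, Primitive cohomology and the tube mapping, Math. Z. 268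
(2010) §7 (Prop. 12, and the Example of a non-injective restriction map); the ping-pong lemma
(folklore, e.g. Lyndon–Schupp, Combinatorial Group Theory, III.12).
-/

-- `Summit.HodgeConjecture.HodgeConjecture.Theorems` is the mandated namespace (single-conjunct summit:
-- Sub = Summit), which `linter.dupNamespace` flags on every declaration; the lakefile turns the
-- linter off tree-wide (weak option), restated here so stand-alone elaboration is warning-free too.
set_option linter.dupNamespace false

noncomputable section

open Matrix

namespace Summit.HodgeConjecture.HodgeConjecture.Theorems


/-! ### The ping-pong dynamics -/

/-- **Ping-pong dynamics of the thin configuration** (the registered stub `stub_thinDynamics` of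
line `Sketch`).  Let a group `G` act on `ℚ²` with three elements `τ 0, τ 1, τ 2` acting as the
integral symplectic transvections `T₁(v) = (v₀ + 4v₁, v₁)`, `T₂(v) = (v₀, v₁ - 4v₀)`,
`T₃(v) = v - 4(v₀ - v₁)(1, 1)` (transvections of `B₀(x,y) = 4(x₀y₁ - x₁y₀)` along `(1,0)`, `(0,1)`,
`(1,1)`).  Then every cyclically reduced alternating product `∏_ℓ (τ i_ℓ)^{n_ℓ}` — a list `L` of
(letter, exponent) pairs with non-zero exponents, consecutive letters distinct, and first letter
different from the last letter — acts with `ρ(∏) - 1` invertible.  (Such products are the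
"hyperbolic" elements of the thin free group `⟨T₁, T₂, T₃⟩`; the statement is what excludes
unexpected unipotent = detecting elements in the counterexample to cyclic detection.) [folklore] -/
theorem localTubeSpan_thinDynamics {G : Type} [Group G] (ρ : Representation ℚ G (Fin 2 → ℚ))
    (τ : Fin 3 → G)
    (hτ₀ : ∀ v, ρ (τ 0) v = ![v 0 + 4 * v 1, v 1])
    (hτ₁ : ∀ v, ρ (τ 1) v = ![v 0, v 1 - 4 * v 0])
    (hτ₂ : ∀ v, ρ (τ 2) v = ![v 0 - 4 * (v 0 - v 1), v 1 - 4 * (v 0 - v 1)])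
    (L : List (Fin 3 × ℤ)) (hL0 : ∀ p ∈ L, p.2 ≠ 0) (hLc : L.IsChain (fun p q => p.1 ≠ q.1))
    (a b : Fin 3 × ℤ) (ha : L.head? = some a) (hb : L.getLast? = some b) (hab : a.1 ≠ b.1) :
    IsUnit (ρ (L.map fun p => τ p.1 ^ p.2).prod - 1) := by
  classical
  /- 1. The transvection data `ρ((τ i)^n) v = v - n ℓ_i(v) d_i` (companion file). -/
  obtain ⟨d, ℓ, hd0, hd1, hd2, hℓ0, hℓ1, hℓ2, hzpow⟩ :=
    localTubeSpan_thin_transvectionData ρ τ hτ₀ hτ₁ hτ₂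
  /- 2. The cones: `cone i v ↔ |P i v| ≤ |Q i v|`, `core i v ↔ |P i v| < |Q i v|` for the linear
    functionals `P = (2v₁, 2v₀, 4(v₀ - v₁))`, `Q = (v₀, v₁, v₀ + v₁)`. -/
  obtain ⟨P, hP0, hP1, hP2⟩ : ∃ P : Fin 3 → (Fin 2 → ℚ) →ₗ[ℚ] ℚ,
      (∀ v, P 0 v = 2 * v 1) ∧ (∀ v, P 1 v = 2 * v 0) ∧ (∀ v, P 2 v = 4 * (v 0 - v 1)) := by
    let π : Fin 2 → ((Fin 2 → ℚ) →ₗ[ℚ] ℚ) := fun j => LinearMap.proj j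
    refine ⟨![(2 : ℚ) • π 1, (2 : ℚ) • π 0, (4 : ℚ) • (π 0 - π 1)],
      fun v => ?_, fun v => ?_, fun v => ?_⟩ <;> simp [π, mul_sub]
  obtain ⟨Q, hQ0, hQ1, hQ2⟩ : ∃ Q : Fin 3 → (Fin 2 → ℚ) →ₗ[ℚ] ℚ,
      (∀ v, Q 0 v = v 0) ∧ (∀ v, Q 1 v = v 1) ∧ (∀ v, Q 2 v = v 0 + v 1) := by
    let π : Fin 2 → ((Fin 2 → ℚ) →ₗ[ℚ] ℚ) := fun j => LinearMap.proj j
    exact ⟨![π 0, π 1, π 0 + π 1], fun v => by simp [π], fun v => by simp [π], fun v => by simp [π]⟩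
  -- (a) two different cones meet only in `0`
  have hdisj : ∀ (i j : Fin 3) (w : Fin 2 → ℚ), i ≠ j → |P i w| ≤ |Q i w| → |P j w| ≤ |Q j w| →
      w = 0 := by
    -- the three unordered pairs, each a short computation with absolute values
    have h01 : ∀ w : Fin 2 → ℚ, |P 0 w| ≤ |Q 0 w| → |P 1 w| ≤ |Q 1 w| → w = 0 := by
      intro w h0 h1
      rw [hP0, hQ0, abs_mul] at h0
      rw [hP1, hQ1, abs_mul] at h1
      exact localTubeSpan_thinCones_disjoint₀₁ w h0 h1
    have h02 : ∀ w : Fin 2 → ℚ, |P 0 w| ≤ |Q 0 w| → |P 2 w| ≤ |Q 2 w| → w = 0 := by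
      intro w h0 h2
      rw [hP0, hQ0, abs_mul] at h0
      rw [hP2, hQ2, abs_mul] at h2
      exact localTubeSpan_thinCones_disjoint₀₂ w h0 h2
    have h12 : ∀ w : Fin 2 → ℚ, |P 1 w| ≤ |Q 1 w| → |P 2 w| ≤ |Q 2 w| → w = 0 := by
      intro w h1 h2
      rw [hP1, hQ1, abs_mul] at h1
      rw [hP2, hQ2, abs_mul] at h2
      exact localTubeSpan_thinCones_disjoint₁₂ w h1 h2
    intro i j w hij hi hj
    match i, j with
    | 0, 0 => exact absurd rfl hij
    | 1, 1 => exact absurd rfl hij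
    | 2, 2 => exact absurd rfl hij
    | 0, 1 => exact h01 w hi hj
    | 1, 0 => exact h01 w hj hi
    | 0, 2 => exact h02 w hi hj
    | 2, 0 => exact h02 w hj hi
    | 1, 2 => exact h12 w hi hj
    | 2, 1 => exact h12 w hj hi
  -- (b) a vector of cone `j` is never in the core of another cone `i`
  have hnotcore : ∀ (i j : Fin 3) (w : Fin 2 → ℚ), i ≠ j → |P j w| ≤ |Q j w| →
      ¬ |P i w| < |Q i w| := by
    intro i j w hij hj hi
    have hw : w = 0 := hdisj i j w hij hi.le hj
    subst hw
    simp at hi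
  -- (c) PING-PONG: `(τ i)^n`, `n ≠ 0`, maps the complement of the core of cone `i` into cone `i`
  have habs := localTubeSpan_abs_le_abs_add_of_le
  have hn1 : ∀ n : ℤ, n ≠ 0 → (1 : ℚ) ≤ |(n : ℚ)| := fun n hn => by
    rw [← Int.cast_abs]; exact_mod_cast Int.one_le_abs hn
  have hmap : ∀ (i : Fin 3) (n : ℤ), n ≠ 0 → ∀ v : Fin 2 → ℚ, ¬ |P i v| < |Q i v| →
      |P i (ρ (τ i ^ n) v)| ≤ |Q i (ρ (τ i ^ n) v)| := by
    intro i n hn v hv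
    rw [not_lt] at hv
    have hn' := hn1 n hn
    rw [hzpow]
    match i with
    | 0 =>
      rw [hP0, hQ0] at hv ⊢
      rw [hℓ0, hd0]
      simp only [Pi.sub_apply, Pi.smul_apply, Matrix.cons_val_zero, Matrix.cons_val_one,
        smul_eq_mul, mul_one, mul_zero, sub_zero]
      rw [abs_mul, abs_two] at hv ⊢
      rw [show v 0 - (n : ℚ) * (-4 * v 1) = v 0 + 4 * n * v 1 by ring]
      refine habs (v 0) (4 * n * v 1) 2 (v 1) ?_ hv
      rw [abs_mul, abs_mul, show |(4 : ℚ)| = 4 by norm_num]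
      nlinarith [abs_nonneg (v 1)]
    | 1 =>
      rw [hP1, hQ1] at hv ⊢
      rw [hℓ1, hd1]
      simp only [Pi.sub_apply, Pi.smul_apply, Matrix.cons_val_zero, Matrix.cons_val_one,
        smul_eq_mul, mul_one, mul_zero, sub_zero]
      rw [abs_mul, abs_two] at hv ⊢
      rw [show v 1 - (n : ℚ) * (4 * v 0) = v 1 + (-4) * n * v 0 by ring]
      refine habs (v 1) ((-4) * n * v 0) 2 (v 0) ?_ hv
      rw [abs_mul, abs_mul, show |(-4 : ℚ)| = 4 by norm_num]
      nlinarith [abs_nonneg (v 0)]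
    | 2 =>
      rw [hP2, hQ2] at hv ⊢
      rw [hℓ2, hd2]
      simp only [Pi.sub_apply, Pi.smul_apply, Matrix.cons_val_zero, Matrix.cons_val_one,
        smul_eq_mul, mul_one]
      rw [abs_mul, show |(4 : ℚ)| = 4 by norm_num] at hv ⊢
      rw [show v 0 - (n : ℚ) * (4 * (v 0 - v 1)) - (v 1 - (n : ℚ) * (4 * (v 0 - v 1))) =
        v 0 - v 1 by ring, show v 0 - (n : ℚ) * (4 * (v 0 - v 1)) + (v 1 - (n : ℚ) *
        (4 * (v 0 - v 1))) = (v 0 + v 1) + (-8) * n * (v 0 - v 1) by ring]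
      refine habs (v 0 + v 1) ((-8) * n * (v 0 - v 1)) 4 (v 0 - v 1) ?_ hv
      rw [abs_mul, abs_mul, show |(-8 : ℚ)| = 8 by norm_num]
      nlinarith [abs_nonneg (v 0 - v 1)]
  /- 3. The mapping property of alternating products: a non-empty alternating list with non-zero
    exponents, first letter `i` and last letter `k`, maps the complement of the core of cone `k`
    into cone `i`. -/
  have key : ∀ (M : List (Fin 3 × ℤ)) (x y : Fin 3 × ℤ), (∀ p ∈ M, p.2 ≠ 0) →
      M.IsChain (fun p q => p.1 ≠ q.1) → M.head? = some x → M.getLast? = some y →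
      ∀ v : Fin 2 → ℚ, ¬ |P y.1 v| < |Q y.1 v| →
        |P x.1 (ρ (M.map fun p => τ p.1 ^ p.2).prod v)| ≤
          |Q x.1 (ρ (M.map fun p => τ p.1 ^ p.2).prod v)| := by
    intro M
    induction M with
    | nil => intro x y _ _ hx; simp at hx
    | cons z M ih =>
      intro x y h0 hc hx hy v hv
      rw [List.head?_cons, Option.some.injEq] at hx
      subst hx
      cases M with
      | nil =>
        rw [List.getLast?_singleton, Option.some.injEq] at hy
        subst hy
        rw [List.map_cons, List.map_nil, List.prod_cons, List.prod_nil, mul_one]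
        exact hmap z.1 z.2 (h0 z (by simp)) v hv
      | cons z' M =>
        rw [List.getLast?_cons_cons] at hy
        have hc' := List.isChain_cons_cons.1 hc
        have ih' := ih z' y (fun p hp => h0 p (List.mem_cons_of_mem _ hp)) hc'.2 rfl hy v hv
        rw [List.map_cons, List.prod_cons, map_mul, Module.End.mul_apply]
        exact hmap z.1 z.2 (h0 z (by simp)) _ (hnotcore z.1 z'.1 _ hc'.1 ih')
  /- 4. Determinant one (companion file). -/
  have hdet1 := localTubeSpan_thin_det_eq_one ρ τ hτ₀ hτ₁ hτ₂
  have hmem : (L.map fun p => τ p.1 ^ p.2).prod ∈ Subgroup.closure (Set.range τ) := by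
    refine Subgroup.list_prod_mem _ fun g hg => ?_
    obtain ⟨p, -, rfl⟩ := List.mem_map.1 hg
    exact Subgroup.zpow_mem _ (Subgroup.subset_closure (Set.mem_range_self p.1)) _
  /- 5. The contradiction. -/
  set g : G := (L.map fun p => τ p.1 ^ p.2).prod with hgdef
  by_contra hnu
  set N : Module.End ℚ (Fin 2 → ℚ) := ρ g - 1 with hNdef
  have hPN : ρ g = 1 + N := by rw [hNdef, add_sub_cancel]
  -- a fixed vector
  have hker : LinearMap.ker N ≠ ⊥ := fun h => hnu ((LinearMap.isUnit_iff_ker_eq_bot N).2 h)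
  obtain ⟨v₀, hv₀N, hv₀⟩ := (Submodule.ne_bot_iff _).1 hker
  rw [LinearMap.mem_ker] at hv₀N
  -- `N² = 0` (determinant one and a fixed vector)
  have hNN : N * N = 0 := by
    set Mx : Matrix (Fin 2) (Fin 2) ℚ := LinearMap.toMatrix' (ρ g) with hMxdef
    have hMxlin : Matrix.toLin' Mx = ρ g := by rw [hMxdef, Matrix.toLin'_toMatrix']
    have hdetM : Mx.det = 1 := by rw [hMxdef, LinearMap.det_toMatrix', hdet1 g hmem]
    have hNlin : Matrix.toLin' (Mx - 1) = N := by
      rw [map_sub, hMxlin, Matrix.toLin'_one, hNdef]; rfl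
    have hdetM1 : (Mx - 1).det = 0 := by
      refine Matrix.exists_mulVec_eq_zero_iff.1 ⟨v₀, hv₀, ?_⟩
      rw [← Matrix.toLin'_apply, hNlin, hv₀N]
    have hsq := localTubeSpan_sq_eq_zero_of_det_fin_two Mx hdetM hdetM1
    rw [← hNlin, Module.End.mul_eq_comp, ← Matrix.toLin'_mul, hsq, map_zero]
  -- the third letter and two independent vectors of its cone
  obtain ⟨m, hma, hmb⟩ : ∃ m : Fin 3, m ≠ a.1 ∧ m ≠ b.1 := by
    revert hab; generalize a.1 = i; generalize b.1 = k; revert i k; decide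
  obtain ⟨η₁, η₂, hη₁, hη₂, hspan⟩ : ∃ η₁ η₂ : Fin 2 → ℚ, |P m η₁| ≤ |Q m η₁| ∧ |P m η₂| ≤ |Q m η₂| ∧
      ∀ w : Fin 2 → ℚ, ∃ c₁ c₂ : ℚ, w = c₁ • η₁ + c₂ • η₂ := by
    match m with
    | 0 =>
      refine ⟨![1, 0], ![2, 1], by simp [hP0, hQ0], by simp [hP0, hQ0], fun w => ?_⟩
      exact ⟨w 0 - 2 * w 1, w 1, by ext j; (fin_cases j <;> simp); ring⟩
    | 1 =>
      refine ⟨![0, 1], ![1, 2], by simp [hP1, hQ1], by simp [hP1, hQ1], fun w => ?_⟩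
      exact ⟨w 1 - 2 * w 0, w 0, by ext j; (fin_cases j <;> simp); ring⟩
    | 2 =>
      refine ⟨![1, 1], ![5, 3], by simp [hP2, hQ2], by norm_num [hP2, hQ2], fun w => ?_⟩
      exact ⟨(5 * w 1 - 3 * w 0) / 2, (w 0 - w 1) / 2, by ext j; fin_cases j <;> simp <;> ring⟩
  -- some vector `η` of cone `m` with `N η ≠ 0`
  obtain ⟨η, hη, hNη⟩ : ∃ η : Fin 2 → ℚ, |P m η| ≤ |Q m η| ∧ N η ≠ 0 := by
    by_contra hnone
    push Not at hnone
    have hN0 : N = 0 := by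
      refine LinearMap.ext fun w => ?_
      obtain ⟨c₁, c₂, rfl⟩ := hspan w
      rw [map_add, map_smul, map_smul, hnone η₁ hη₁, hnone η₂ hη₂, smul_zero, smul_zero, add_zero,
        LinearMap.zero_apply]
    -- then `ρ g = 1`, contradicting ping-pong: `η₁ ≠ 0`? use any non-zero vector of cone `m`
    have hg1 : ρ g = 1 := by rw [hPN, hN0, add_zero]
    -- `η₁` or `η₂` is non-zero since they span
    obtain ⟨η, hηc, hη0⟩ : ∃ η : Fin 2 → ℚ, |P m η| ≤ |Q m η| ∧ η ≠ 0 := by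
      by_cases h1 : η₁ = 0
      · refine ⟨η₂, hη₂, fun h2 => ?_⟩
        obtain ⟨c₁, c₂, hc⟩ := hspan ![1, 0]
        rw [h1, h2, smul_zero, smul_zero, add_zero] at hc
        exact one_ne_zero (congr_fun hc 0)
      · exact ⟨η₁, hη₁, h1⟩
    have h1 := key L a b hL0 hLc ha hb η (hnotcore b.1 m η (Ne.symm hmb) hηc)
    rw [← hgdef, hg1, Module.End.one_apply] at h1
    exact hη0 (hdisj a.1 m η (Ne.symm hma) h1 hηc)
  have hη0 : η ≠ 0 := fun h => hNη (by rw [h, map_zero])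
  -- forward orbit: `(ρ g)^n η ∈ cone a.1`
  have hfwd : ∀ n : ℕ, 1 ≤ n → |P a.1 ((ρ g ^ n) η)| ≤ |Q a.1 ((ρ g ^ n) η)| := by
    intro n hn
    induction n with
    | zero => exact absurd hn (by omega)
    | succ n ih =>
      rw [pow_succ', Module.End.mul_apply]
      rcases Nat.eq_zero_or_pos n with rfl | hpos
      · rw [pow_zero, Module.End.one_apply, hgdef]
        exact key L a b hL0 hLc ha hb η (hnotcore b.1 m η (Ne.symm hmb) hη)
      · rw [hgdef]
        exact key L a b hL0 hLc ha hb _ (hnotcore b.1 a.1 _ (Ne.symm hab) (ih hpos))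
  -- backward orbit: `(ρ g⁻¹)^n η ∈ cone b.1`, by the mapping property of the reversed list
  set L' : List (Fin 3 × ℤ) := (L.map fun p => (p.1, -p.2)).reverse with hL'def
  have hL'prod : (L'.map fun p => τ p.1 ^ p.2).prod = g⁻¹ := by
    rw [hgdef, List.prod_inv_reverse, hL'def, List.map_reverse, List.map_map, List.map_map]
    congr 1
    congr 1
    refine List.map_congr_left fun p _ => ?_
    simp only [Function.comp_apply, zpow_neg]
  have hL'0 : ∀ p ∈ L', p.2 ≠ 0 := by
    intro p hp
    rw [hL'def, List.mem_reverse, List.mem_map] at hp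
    obtain ⟨q, hq, rfl⟩ := hp
    exact neg_ne_zero.2 (hL0 q hq)
  have hL'c : L'.IsChain (fun p q => p.1 ≠ q.1) := by
    rw [hL'def, List.isChain_reverse, List.isChain_map]
    exact hLc.imp fun _ _ h => Ne.symm h
  have hL'head : L'.head? = some (b.1, -b.2) := by
    rw [hL'def, List.head?_reverse, List.getLast?_map, hb]; rfl
  have hL'last : L'.getLast? = some (a.1, -a.2) := by
    rw [hL'def, List.getLast?_reverse, List.head?_map, ha]; rfl
  have hbwd : ∀ n : ℕ, 1 ≤ n → |P b.1 ((ρ g⁻¹ ^ n) η)| ≤ |Q b.1 ((ρ g⁻¹ ^ n) η)| := by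
    intro n hn
    induction n with
    | zero => exact absurd hn (by omega)
    | succ n ih =>
      rw [pow_succ', Module.End.mul_apply]
      rcases Nat.eq_zero_or_pos n with rfl | hpos
      · rw [pow_zero, Module.End.one_apply]
        have := key L' _ _ hL'0 hL'c hL'head hL'last η (hnotcore a.1 m η (Ne.symm hma) hη)
        rwa [hL'prod] at this
      · have := key L' _ _ hL'0 hL'c hL'head hL'last _ (hnotcore a.1 b.1 _ hab (ih hpos))
        rwa [hL'prod] at this
  -- the orbits are `η ± n Nη`
  have hinvN : ρ g⁻¹ = 1 + (-N) := by
    have h1 : ρ g⁻¹ * ρ g = 1 := by rw [← map_mul, inv_mul_cancel, map_one]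
    have h2 : ρ g * (1 - N) = 1 := by
      rw [hPN]
      simp only [add_mul, mul_sub, one_mul, mul_one, hNN]
      abel
    calc ρ g⁻¹ = ρ g⁻¹ * (ρ g * (1 - N)) := by rw [h2, mul_one]
      _ = 1 + (-N) := by rw [← mul_assoc, h1, one_mul, sub_eq_add_neg]
  have hNN' : (-N) * (-N) = 0 := by
    rw [← hNN]
    ext v
    simp [Module.End.mul_apply]
  have hfwd' : ∀ n : ℕ, 1 ≤ n → |P a.1 (η + (n : ℚ) • N η)| ≤ |Q a.1 (η + (n : ℚ) • N η)| := by
    intro n hn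
    have := hfwd n hn
    rwa [hPN, localTubeSpan_one_add_pow_of_sq_zero N hNN n, LinearMap.add_apply,
      LinearMap.smul_apply, Module.End.one_apply] at this
  have hbwd' : ∀ n : ℕ, 1 ≤ n →
      |P b.1 (η + (n : ℚ) • (-N) η)| ≤ |Q b.1 (η + (n : ℚ) • (-N) η)| := by
    intro n hn
    have := hbwd n hn
    rwa [hinvN, localTubeSpan_one_add_pow_of_sq_zero (-N) hNN' n, LinearMap.add_apply,
      LinearMap.smul_apply, Module.End.one_apply] at this
  -- closedness under `n → ∞`: `Nη ∈ cone a.1` and `-Nη ∈ cone b.1`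
  have hlim : ∀ (i : Fin 3) (z : Fin 2 → ℚ),
      (∀ n : ℕ, 1 ≤ n → |P i (η + (n : ℚ) • z)| ≤ |Q i (η + (n : ℚ) • z)|) → |P i z| ≤ |Q i z| := by
    intro i z h
    refine localTubeSpan_abs_le_abs_of_forall_nat (x := P i η) (x' := Q i η) fun n hn => ?_
    have := h n hn
    rwa [map_add, map_add, map_smul, map_smul, smul_eq_mul, smul_eq_mul] at this
  have hz1 : |P a.1 (N η)| ≤ |Q a.1 (N η)| := hlim a.1 (N η) hfwd'
  have hz2 : |P b.1 (N η)| ≤ |Q b.1 (N η)| := by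
    have := hlim b.1 ((-N) η) hbwd'
    rwa [LinearMap.neg_apply, map_neg, map_neg, abs_neg, abs_neg] at this
  exact hNη (hdisj a.1 b.1 (N η) hab hz1 hz2)

end Summit.HodgeConjecture.HodgeConjecture.Theorems

end
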